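import Summits.RiemannHypothesis.RiemannHypothesis.Theorems.Splittings.RobinFiniteE3Large
import Literature.NumberTheory.LFunctions.FordZetaZeroRecipSqSum
import HarnessLib

/-!
# Splittings — Robin finite lens, E3 (the CA Mertens certificate re-read with window hypotheses), part 5/6, §E

Cell rh-split, seat rh-split-robin-finite g7 (brief sha16 f79c5f09d8bcb036), card `run/shared/lean/pub/rh-split/cards/SPLIT-robin-finite.md` §14
(referee rh-split-ref g3 REFEREE ADDENDUM (robin, finite) §14 DELIVERABLE + REPLAY ×2 2026-08-27T05:39:31Z; lead rh-split-lead g3 RULING #24: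
zero-def variant of record); cut of `HOME/rh-split-robin-finite/SketchG7-E3-zerodef.lean` (sha16 c3a3285c0daab218, 1644 l, 52 thms, ZERO defs —
generated by the seat from SketchG7-E3.lean deb49c670b0d4cda by spelling out `ThetaWindow` / `EBoxOn` / `Eb` / `budgetPT`) into SIX files
(`RobinFiniteE3Window` §A, `…Combine` §B, `…Cells` §C, `…Large` §D, `…Error` §E, `…Main` §F; the card's five-file plan puts §A+§B in one
file, which is 428 l > the 400-line rule), filed by rh-split-typer-1 g4.  Decl blocks byte-identical to the scratch; one namespace
`…Theorems.Splittings.RobinFiniteE3` (scratch: `…Splittings.RobinFinite.E3Z`).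

This part — part 5/6, §E: the error side `Eb b x = E_RH(x) + (b − β)·(…)` (spelled out), its closed form and boxes (`Eb_mul_eq`, `Eb_mul_le_box`, `eboxOn_Eb`,
`budgetPT_cells_le`), and the six certified large windows up to `X₁ = 2.5·10²⁰` (`Eb_lt_W1` … `Eb_lt_W6`, rational enclosures by `norm_num`;
`FordL33.nicolasBeta_lt_d5`).  RH-free.

E3 of the card's exchange lemma = the MECHANICAL RE-READ of the tree's CA Mertens certificate `RobinAnalyticSharp.mertens_prod_lt_RH`
with its two RH uses replaced: (θ) Schoenfeld's `|θ t − t| ≤ √t log² t/(8π)` by a WINDOW hypothesis `∀ y ∈ [599, B], |θ y − y| ≤ √y log² y/(8π)`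
(spelled out), and (f) Nicolas's `−log f(P) ≤ E_RH(P)` by an ABSTRACT error value / function, so that the tree's RH-free inputs
`RobinFiniteE1c.schoenfeldThetaOn_of_buthe2016` and `RobinFiniteTail(Free).nicolasLowerBetween_PT_tailFree` plug in (in `…Main`).
No new analytic idea: every proof is the tree's, with `hS hRH` ↦ `hW … (t ≤ B)` and `nicolasERH_mul_le` ↦ a hypothesis.
HONEST LABEL: «SPLITTING SEARCH over kernel-typed RH-EQUIVALENCES; a splitting A ∧ B ⟹ RH is CONDITIONAL bookkeeping
unless A and B are both proved; nothing here bears on the truth of RH.»  Referee labels: class (robin, finite) UNCHANGED (RELABELLING ×4,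
tail-rigid); the conditional headline's modulo-list is PRINT-ONLY {Buthe2016_thm2, Buthe2018_thm2_theta, BroadbentEtAl2021_theta_rel_1e19, RH(H₀)}.
-/

set_option linter.dupNamespace false

noncomputable section

open Real Filter Finset
open scoped Chebyshev

namespace Summit.RiemannHypothesis.RiemannHypothesis.Theorems.Splittings.RobinFiniteE3

open Literature.NumberTheory.LFunctions
open RobinAnalyticSharp

/-! ## §E · The error side: `Eb b` (budget `b` in place of `β`), its boxes and the six large windows -/

/- (spelled out, was a def)  `Eb b x = E_RH(x) + (b − β)·(1/(√x log x) + 1/(√x log² x) + 4/(√x log³ x))` — verbatim the right-hand side of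
`RobinFiniteTail.nicolasLowerBetween_PT_tailFree` (Nicolas's (2.18) with the zero-sum constant `β` replaced by a
budget `b`). -/
/- (spelled out, was a def)  The RH-free zero budget of the tree's windowed lower bound on `[X₀, X₁]`:
`0.0463 + 2(1 + 2/log X₀)·2.961·10⁻¹²·√X₁`. -/
/-- `Eb` is monotone in the budget (`x > 1`). -/
theorem Eb_mono {b b' x : ℝ} (hx : 1 < x) (hb : b ≤ b') : (nicolasERH x + (b - nicolasBeta) * (1 / (√x * Real.log x) + 1 / (√x * Real.log x ^ 2) + 4 / (√x * Real.log x ^ 3))) ≤ (nicolasERH x + (b' - nicolasBeta) * (1 / (√x * Real.log x) + 1 / (√x * Real.log x ^ 2) + 4 / (√x * Real.log x ^ 3))) := by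
  have hs : 0 < √x := Real.sqrt_pos.2 (by linarith)
  have hL : 0 < Real.log x := Real.log_pos hx
  have hw : 0 ≤ 1 / (√x * Real.log x) + 1 / (√x * Real.log x ^ 2) + 4 / (√x * Real.log x ^ 3) := by
    positivity
  nlinarith [mul_le_mul_of_nonneg_right hb hw]

/-- `Eb b P · √P log P` in closed form (`β` cancels): with `L = log P`,
`(b + 2.042) − (2.042 − b)/L + (8.168 + 4b)/L² + log(2π)/√P + 2/P^{1/6} + L⁴/(64π²√P)`. -/
theorem Eb_mul_eq {b P : ℝ} (hP : 1 < P) :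
    (nicolasERH P + (b - nicolasBeta) * (1 / (√P * Real.log P) + 1 / (√P * Real.log P ^ 2) + 4 / (√P * Real.log P ^ 3))) * (√P * Real.log P) =
      (b + 2.042) - (2.042 - b) / Real.log P + (8.168 + 4 * b) / Real.log P ^ 2 +
      Real.log (2 * π) / √P + 2 / P ^ ((1 : ℝ) / 6) + Real.log P ^ 4 / √P / (64 * π ^ 2) := by
  have hP0 : 0 < P := by linarith
  have hs0 : 0 < √P := Real.sqrt_pos.2 hP0
  have hL0 : 0 < Real.log P := Real.log_pos hP
  have h1 := nicolasERH_mul_eq hP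
  have e : (nicolasERH P + (b - nicolasBeta) * (1 / (√P * Real.log P) + 1 / (√P * Real.log P ^ 2) + 4 / (√P * Real.log P ^ 3))) * (√P * Real.log P) = nicolasERH P * (√P * Real.log P) +
      (b - nicolasBeta) * ((1 / (√P * Real.log P) + 1 / (√P * Real.log P ^ 2)
        + 4 / (√P * Real.log P ^ 3)) * (√P * Real.log P)) := by
    ring
  have e2 : (1 / (√P * Real.log P) + 1 / (√P * Real.log P ^ 2) + 4 / (√P * Real.log P ^ 3))
      * (√P * Real.log P) = 1 + 1 / Real.log P + 4 / Real.log P ^ 2 := by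
    field_simp
  rw [e, e2, h1]
  ring

/-- **`Eb b'` satisfies the cells' box hypothesis at the cells' budget `0.0552`** whenever `β ≤ b'` and
`1.1875·b' ≤ 0.0552` (e.g. `b' ≤ 0.04648`): `Eb b' = E_RH + (b' − β)(…)`, `E_RH·√P log P ≤ eBox β …` (the tree's
`nicolasERH_mul_le` at `b = β`), `eBox 0.0552 − eBox β ≥ 0.0552 − β`, and `(b' − β)(1 + 1/L + 4/L²) ≤ 1.1875 b' − β`
(`L ≥ 8`, `β ≥ 0`). -/
theorem eboxOn_Eb {b' : ℝ} (hb : nicolasBeta ≤ b') (hb' : b' * 1.1875 ≤ ((Cells.bU : ℚ) : ℝ)) :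
    (∀ ⦃P P₁ P₂ L₁ U₁ L₂ s₁ p16 : ℝ⦄, 599 ≤ P₁ → P₁ ≤ P → P ≤ P₂ → L₁ ≤ Real.log P₁ → Real.log P₁ ≤ U₁ → Real.log P₂ ≤ L₂ → 8 ≤ L₁ → s₁ ≤ √P₁ → 0 < s₁ → 0 < p16 → 1 ≤ p16 ^ 6 * P₁ → (nicolasERH P + (b' - nicolasBeta) * (1 / (√P * Real.log P) + 1 / (√P * Real.log P ^ 2) + 4 / (√P * Real.log P ^ 3))) * (√P * Real.log P) ≤ eBox ((Cells.bU : ℚ) : ℝ) L₁ U₁ L₂ s₁ (p16 + 0.0224)) := by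
  intro P P₁ P₂ L₁ U₁ L₂ s₁ p16 hP₁ hPl hPu hL₁ hU₁ hL₂ hL₁8 hs₁ hs₁0 hp16 hp16'
  have hβ0 : 0 ≤ nicolasBeta := le_trans (by norm_num) nicolasBeta_gt.le
  have hβ2 : nicolasBeta ≤ 2 := by linarith [nicolasBeta_lt]
  have hE := nicolasERH_mul_le (le_refl nicolasBeta) hβ2 hP₁ hPl hPu hL₁ hU₁ hL₂ hL₁8 hs₁ hs₁0 hp16 hp16'
  have hP0 : 0 < P := by linarith
  have hP1 : 1 < P := by linarith
  have hs0 : 0 < √P := Real.sqrt_pos.2 hP0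
  have hL0 : 0 < Real.log P := Real.log_pos hP1
  have hLl : L₁ ≤ Real.log P := hL₁.trans (Real.log_le_log (by linarith) hPl)
  have hL8 : 8 ≤ Real.log P := hL₁8.trans hLl
  have hL₂8 : 8 ≤ L₂ := hL8.trans ((Real.log_le_log hP0 hPu).trans hL₂)
  have e2 : (1 / (√P * Real.log P) + 1 / (√P * Real.log P ^ 2) + 4 / (√P * Real.log P ^ 3))
      * (√P * Real.log P) = 1 + 1 / Real.log P + 4 / Real.log P ^ 2 := by
    field_simp
  have hw : 1 + 1 / Real.log P + 4 / Real.log P ^ 2 ≤ 1.1875 := by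
    have h1 : 1 / Real.log P ≤ 1 / 8 := one_div_le_one_div_of_le (by norm_num) hL8
    have h2 : 4 / Real.log P ^ 2 ≤ 4 / 64 :=
      div_le_div_of_nonneg_left (by norm_num) (by norm_num) (by nlinarith)
    linarith
  have eB : eBox ((Cells.bU : ℚ) : ℝ) L₁ U₁ L₂ s₁ (p16 + 0.0224) -
      eBox nicolasBeta L₁ U₁ L₂ s₁ (p16 + 0.0224) =
      (((Cells.bU : ℚ) : ℝ) - nicolasBeta) * (1 + 1 / L₂ + 4 / L₁ ^ 2) := by
    unfold eBox; ring
  have hbU : nicolasBeta ≤ ((Cells.bU : ℚ) : ℝ) := by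
    have := nicolasBeta_lt; simp only [Cells.bU]; push_cast; linarith
  have hdiff : ((Cells.bU : ℚ) : ℝ) - nicolasBeta ≤ eBox ((Cells.bU : ℚ) : ℝ) L₁ U₁ L₂ s₁ (p16 + 0.0224) -
      eBox nicolasBeta L₁ U₁ L₂ s₁ (p16 + 0.0224) := by
    rw [eB]
    have h1 : 0 ≤ 1 / L₂ := by positivity
    have h2 : 0 ≤ 4 / L₁ ^ 2 := by positivity
    nlinarith
  have e : (nicolasERH P + (b' - nicolasBeta) * (1 / (√P * Real.log P) + 1 / (√P * Real.log P ^ 2) + 4 / (√P * Real.log P ^ 3))) * (√P * Real.log P) = nicolasERH P * (√P * Real.log P) +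
      (b' - nicolasBeta) * (1 + 1 / Real.log P + 4 / Real.log P ^ 2) := by
    rw [← e2]; ring
  rw [e]
  have hx : (b' - nicolasBeta) * (1 + 1 / Real.log P + 4 / Real.log P ^ 2) ≤
      ((Cells.bU : ℚ) : ℝ) - nicolasBeta := by
    have h1 : (b' - nicolasBeta) * (1 + 1 / Real.log P + 4 / Real.log P ^ 2) ≤
        (b' - nicolasBeta) * 1.1875 := mul_le_mul_of_nonneg_left hw (by linarith)
    linarith
  linarith

/-- The cells' budget: `budgetPT 4¹¹ (2·10¹⁰) ≤ 0.04631` (`log 4¹¹ ≥ 15.249`, `√(2·10¹⁰) ≤ 141422`). -/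
theorem budgetPT_cells_le : (0.0463 + 2 * (1 + 2 / Real.log ((4 : ℝ) ^ 11)) * (2.961e-12 * √(2 * 10 ^ 10))) ≤ 0.04631 := by
  have hlog : (15.249 : ℝ) ≤ Real.log ((4 : ℝ) ^ 11) := by
    rw [Cells.log_four_pow]; have := Real.log_two_gt_d9; push_cast; linarith
  have hsq : √(2 * 10 ^ 10 : ℝ) ≤ 141422 :=
    (Real.sqrt_le_sqrt (by norm_num : (2 * 10 ^ 10 : ℝ) ≤ 141422 ^ 2)).trans_eq
      (Real.sqrt_sq (by norm_num))
  have hl0 : (0 : ℝ) < Real.log ((4 : ℝ) ^ 11) := lt_of_lt_of_le (by norm_num) hlog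
  have h1 : 2 / Real.log ((4 : ℝ) ^ 11) ≤ 2 / 15.249 :=
    div_le_div_of_nonneg_left (by norm_num) (by norm_num) hlog
  have h0 : 0 ≤ 2 / Real.log ((4 : ℝ) ^ 11) := div_nonneg (by norm_num) hl0.le
  have h3 : (2.961e-12 : ℝ) * √(2 * 10 ^ 10 : ℝ) ≤ 2.961e-12 * 141422 :=
    mul_le_mul_of_nonneg_left hsq (by norm_num)
  have h2 : (1 + 2 / Real.log ((4 : ℝ) ^ 11)) * (2.961e-12 * √(2 * 10 ^ 10 : ℝ)) ≤
      (1 + 2 / 15.249) * (2.961e-12 * 141422) :=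
    mul_le_mul (by linarith) h3 (by positivity) (by positivity)
  have h4 : (1 + 2 / 15.249) * (2.961e-12 * 141422 : ℝ) ≤ 0.000000948 := by norm_num
  linarith

/-- **Box bound for `Eb b` on a window `[X₀, X₁]`** (the term bounds of `nicolasE_mul_le`): with `8 ≤ L₁ ≤ log X₀ ≤ U₁`,
`log X₁ ≤ L₂`, `0 < s₁ ≤ √X₀`, `0 < y₁ ≤ X₀^{1/6}`, `0 ≤ b ≤ 2.042`:
`Eb b P·√P log P ≤ (b + 2.042) − (2.042 − b)/L₂ + (8.168 + 4b)/L₁² + 1.84/s₁ + 2/y₁ + U₁⁴/(631.65 s₁)`. -/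
theorem Eb_mul_le_box {b P X₀ X₁ L₁ U₁ L₂ s₁ y₁ : ℝ} (hb0 : 0 ≤ b) (hb : b ≤ 2.042) (hX₀ : 1 < X₀)
    (hPl : X₀ ≤ P) (hPu : P ≤ X₁) (hL₁ : L₁ ≤ Real.log X₀) (hU₁ : Real.log X₀ ≤ U₁)
    (hL₂ : Real.log X₁ ≤ L₂) (hL₁8 : 8 ≤ L₁) (hs₁ : s₁ ≤ √X₀) (hs₁0 : 0 < s₁)
    (hy₁ : y₁ ≤ X₀ ^ ((1 : ℝ) / 6)) (hy₁0 : 0 < y₁) :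
    (nicolasERH P + (b - nicolasBeta) * (1 / (√P * Real.log P) + 1 / (√P * Real.log P ^ 2) + 4 / (√P * Real.log P ^ 3))) * (√P * Real.log P) ≤
      (b + 2.042) - (2.042 - b) / L₂ + (8.168 + 4 * b) / L₁ ^ 2 + 1.84 / s₁ + 2 / y₁ +
        U₁ ^ 4 / (631.65 * s₁) := by
  have hX₀0 : 0 < X₀ := by linarith
  have hP0 : 0 < P := by linarith
  have hP1 : 1 < P := by linarith
  rw [Eb_mul_eq hP1]
  set L := Real.log P with hL
  set s := √P with hs
  set y := P ^ ((1 : ℝ) / 6) with hy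
  have hs0 : 0 < s := Real.sqrt_pos.2 hP0
  have hLX₀ : Real.log X₀ ≤ L := Real.log_le_log hX₀0 hPl
  have hLl : L₁ ≤ L := hL₁.trans hLX₀
  have hLu : L ≤ L₂ := (Real.log_le_log hP0 hPu).trans hL₂
  have hL0 : 0 < L := by linarith
  have hsl : s₁ ≤ s := hs₁.trans (Real.sqrt_le_sqrt hPl)
  have hyl : y₁ ≤ y := hy₁.trans (Real.rpow_le_rpow hX₀0.le hPl (by norm_num))
  have b2 : -((2.042 - b) / L) ≤ -((2.042 - b) / L₂) := by
    have h1 : (2.042 - b) / L₂ ≤ (2.042 - b) / L := div_le_div_of_nonneg_left (by linarith) hL0 hLu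
    linarith
  have b3 : (8.168 + 4 * b) / L ^ 2 ≤ (8.168 + 4 * b) / L₁ ^ 2 := by
    apply div_le_div_of_nonneg_left (by linarith) (by positivity)
    exact pow_le_pow_left₀ (by linarith) hLl 2
  have b4 : Real.log (2 * π) / s ≤ 1.84 / s₁ := by
    have h0 : 0 ≤ Real.log (2 * π) := Real.log_nonneg (by linarith [Real.pi_gt_three])
    calc Real.log (2 * π) / s ≤ Real.log (2 * π) / s₁ := div_le_div_of_nonneg_left h0 hs₁0 hsl
      _ ≤ 1.84 / s₁ := div_le_div_of_nonneg_right log_two_pi_le hs₁0.le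
  have b5 : 2 / y ≤ 2 / y₁ := div_le_div_of_nonneg_left (by norm_num) hy₁0 hyl
  have b6 : L ^ 4 / s / (64 * π ^ 2) ≤ U₁ ^ 4 / (631.65 * s₁) := by
    have hanti := log_pow_div_rpow_le (a := 1 / 2) (by norm_num) (k := 4) (by norm_num) hX₀0
      (le_trans (by norm_num) (hL₁8.trans hL₁)) hPl
    have e1 : L ^ 4 / s = Real.log P ^ 4 / P ^ ((1 : ℝ) / 2) := by rw [hs, Real.sqrt_eq_rpow]
    have e2 : Real.log X₀ ^ 4 / X₀ ^ ((1 : ℝ) / 2) ≤ U₁ ^ 4 / s₁ := by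
      have h0 : 0 ≤ Real.log X₀ := by linarith
      calc Real.log X₀ ^ 4 / X₀ ^ ((1 : ℝ) / 2) ≤ U₁ ^ 4 / X₀ ^ ((1 : ℝ) / 2) :=
            div_le_div_of_nonneg_right (pow_le_pow_left₀ h0 hU₁ 4) (by positivity)
        _ ≤ U₁ ^ 4 / s₁ := by
            apply div_le_div_of_nonneg_left (by positivity) hs₁0
            rwa [← Real.sqrt_eq_rpow]
    have hpi : (9.8696 : ℝ) ≤ π ^ 2 := pi_sq_ge
    calc L ^ 4 / s / (64 * π ^ 2) ≤ U₁ ^ 4 / s₁ / (64 * π ^ 2) := by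
          rw [e1]; exact div_le_div_of_nonneg_right (hanti.trans e2) (by positivity)
      _ ≤ U₁ ^ 4 / s₁ / 631.65 := by
          apply div_le_div_of_nonneg_left (by positivity) (by norm_num); linarith
      _ = U₁ ^ 4 / (631.65 * s₁) := by rw [div_div, mul_comm]
  linarith

/-- Budget monotonicity: `budgetPT X₀ X₁ ≤ b` from `L₁ ≤ log X₀`, `√X₁ ≤ u` and the rational check. -/
theorem budgetPT_le {X₀ X₁ L₁ u b : ℝ} (hL₁ : L₁ ≤ Real.log X₀) (hL₁0 : 0 < L₁) (hu : √X₁ ≤ u)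
    (h : 0.0463 + 2 * (1 + 2 / L₁) * (2.961e-12 * u) ≤ b) : (0.0463 + 2 * (1 + 2 / Real.log X₀) * (2.961e-12 * √X₁)) ≤ b := by
  have h2 : 2 / Real.log X₀ ≤ 2 / L₁ := div_le_div_of_nonneg_left (by norm_num) hL₁0 hL₁
  have h4 : 0 ≤ 2 / Real.log X₀ := div_nonneg (by norm_num) (hL₁0.le.trans hL₁)
  have h5 : (1 + 2 / Real.log X₀) * (2.961e-12 * √X₁) ≤ (1 + 2 / L₁) * (2.961e-12 * u) :=
    mul_le_mul (by linarith) (mul_le_mul_of_nonneg_left hu (by norm_num)) (by positivity)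
      (by positivity)
  linarith

/-- **One large window**: on `[X₀, X₁]` with enclosures `(L₁, U₁, L₂, s₁, y₁, u)` and a budget `b ≥ budgetPT X₀ X₁`
whose box is `< 2.1538`, `Eb (budgetPT X₀ X₁) P · √P log P < 2.1538`. -/
theorem Eb_window_lt {b X₀ X₁ L₁ U₁ L₂ s₁ y₁ u P : ℝ} (hX₀ : 1 < X₀) (h0 : X₀ ≤ P) (h1 : P ≤ X₁)
    (hL₁ : L₁ ≤ Real.log X₀) (hU₁ : Real.log X₀ ≤ U₁) (hL₂ : Real.log X₁ ≤ L₂) (hL₁8 : 8 ≤ L₁)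
    (hs₁ : s₁ ≤ √X₀) (hs₁0 : 0 < s₁) (hy₁ : y₁ ≤ X₀ ^ ((1 : ℝ) / 6)) (hy₁0 : 0 < y₁) (hu : √X₁ ≤ u)
    (hbud : 0.0463 + 2 * (1 + 2 / L₁) * (2.961e-12 * u) ≤ b) (hb0 : 0 ≤ b) (hb : b ≤ 2.042)
    (hbox : (b + 2.042) - (2.042 - b) / L₂ + (8.168 + 4 * b) / L₁ ^ 2 + 1.84 / s₁ + 2 / y₁ +
        U₁ ^ 4 / (631.65 * s₁) < 2.1538) :
    (nicolasERH P + ((0.0463 + 2 * (1 + 2 / Real.log X₀) * (2.961e-12 * √X₁)) - nicolasBeta) * (1 / (√P * Real.log P) + 1 / (√P * Real.log P ^ 2) + 4 / (√P * Real.log P ^ 3))) * (√P * Real.log P) < 2.1538 := by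
  have hP1 : 1 < P := by linarith
  have hsL : 0 < √P * Real.log P := mul_pos (Real.sqrt_pos.2 (by linarith)) (Real.log_pos hP1)
  have hbW := budgetPT_le hL₁ (by linarith) hu hbud
  have hm := mul_le_mul_of_nonneg_right (Eb_mono hP1 hbW) hsL.le
  have hbox' := Eb_mul_le_box hb0 hb hX₀ h0 h1 hL₁ hU₁ hL₂ hL₁8 hs₁ hs₁0 hy₁ hy₁0
  linarith

/-! ### Numerical enclosures at the window endpoints `2·10¹⁰ | 10¹⁶ | 10¹⁹ | 5·10¹⁹ | 1.25·10²⁰ | 2·10²⁰ | 2.5·10²⁰` -/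

/-- `y ≤ X^{1/6}` from `y⁶ ≤ X`. -/
theorem le_rpow_sixth {y X : ℝ} (hX : 0 ≤ X) (h : y ^ 6 ≤ X) : y ≤ X ^ ((1 : ℝ) / 6) := by
  by_contra hlt
  rw [not_le] at hlt
  have h0 : 0 ≤ X ^ ((1 : ℝ) / 6) := by positivity
  have h6 := pow_lt_pow_left₀ hlt h0 (by norm_num : (6 : ℕ) ≠ 0)
  have e : (X ^ ((1 : ℝ) / 6)) ^ 6 = X := by
    rw [← Real.rpow_mul_natCast hX]; norm_num
  rw [e] at h6
  linarith

/-- `s ≤ √X` from `s² ≤ X`, and `√X ≤ u` from `X ≤ u²`, `0 ≤ u`. -/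
theorem sqrt_between {s u X : ℝ} (hs : s ^ 2 ≤ X) (hu0 : 0 ≤ u) (hu : X ≤ u ^ 2) : s ≤ √X ∧ √X ≤ u :=
  ⟨Real.le_sqrt_of_sq_le hs, (Real.sqrt_le_sqrt hu).trans_eq (Real.sqrt_sq hu0)⟩

/-- `log 10^n` enclosure from `log 10 ∈ (2.3025850925, 2.3025850935)`. -/
theorem log_ten_pow_bounds (n : ℕ) :
    (n : ℝ) * 2.3025850925 ≤ Real.log ((10 : ℝ) ^ n) ∧ Real.log ((10 : ℝ) ^ n) ≤ n * 2.3025850935 := by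
  rw [Real.log_pow]
  have h1 := RobinAnalytic.log_ten_gt
  have h2 := RobinAnalytic.log_ten_lt
  have hn : (0 : ℝ) ≤ n := Nat.cast_nonneg n
  constructor <;> nlinarith

/-- `log (a · 10^n) = log a + n log 10` (`a > 0`). -/
theorem log_mul_ten_pow {a : ℝ} (ha : 0 < a) (n : ℕ) :
    Real.log (a * (10 : ℝ) ^ n) = Real.log a + n * Real.log 10 := by
  rw [Real.log_mul ha.ne' (by positivity), Real.log_pow]

/-- `log 5` enclosure (Mathlib's `d9` bounds, widened). -/
theorem log_five_bounds : (1.60943791 : ℝ) ≤ Real.log 5 ∧ Real.log 5 ≤ 1.60943792 := by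
  have := Real.log_five_gt_d9; have := Real.log_five_lt_d9
  constructor <;> linarith

/-- Window 1: `[2·10¹⁰, 10¹⁶]`, budget `0.046943`, box `2.0916 < 2.1538`. -/
theorem Eb_lt_W1 {P : ℝ} (h0 : (2 * 10 ^ 10 : ℝ) ≤ P) (h1 : P ≤ (10 : ℝ) ^ 16) :
    (nicolasERH P + ((0.0463 + 2 * (1 + 2 / Real.log (2 * 10 ^ 10)) * (2.961e-12 * √((10 : ℝ) ^ 16))) - nicolasBeta) * (1 / (√P * Real.log P) + 1 / (√P * Real.log P ^ 2) + 4 / (√P * Real.log P ^ 3))) * (√P * Real.log P) < 2.1538 := by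
  have hl0 := RobinAnalytic.log_2e10_gt
  have hu0 := log_2e10_le
  obtain ⟨-, hu1⟩ := log_ten_pow_bounds 16
  obtain ⟨hs, -⟩ := sqrt_between (s := 141421) (u := 141422) (X := (2 * 10 ^ 10 : ℝ))
    (by norm_num) (by norm_num) (by norm_num)
  obtain ⟨-, hu⟩ := sqrt_between (s := (10 : ℝ) ^ 8) (u := (10 : ℝ) ^ 8) (X := (10 : ℝ) ^ 16)
    (by norm_num) (by norm_num) (by norm_num)
  have hy := le_rpow_sixth (X := (2 * 10 ^ 10 : ℝ)) (y := 52.1) (by norm_num) (by norm_num)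
  exact Eb_window_lt (b := 0.046943) (L₁ := 23.718) (U₁ := 23.719) (L₂ := 36.842) (by norm_num) h0 h1
    hl0.le hu0 (by push_cast at hu1; linarith) (by norm_num) hs (by norm_num) hy (by norm_num) hu
    (by norm_num) (by norm_num) (by norm_num) (by norm_num)

/-- Window 2: `[10¹⁶, 10¹⁹]`, budget `0.066044`, box `2.0735`. -/
theorem Eb_lt_W2 {P : ℝ} (h0 : (10 : ℝ) ^ 16 ≤ P) (h1 : P ≤ (10 : ℝ) ^ 19) :
    (nicolasERH P + ((0.0463 + 2 * (1 + 2 / Real.log ((10 : ℝ) ^ 16)) * (2.961e-12 * √((10 : ℝ) ^ 19))) - nicolasBeta) * (1 / (√P * Real.log P) + 1 / (√P * Real.log P ^ 2) + 4 / (√P * Real.log P ^ 3))) * (√P * Real.log P) < 2.1538 := by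
  obtain ⟨hl0, hu0⟩ := log_ten_pow_bounds 16
  obtain ⟨-, hu1⟩ := log_ten_pow_bounds 19
  obtain ⟨hs, -⟩ := sqrt_between (s := (10 : ℝ) ^ 8) (u := (10 : ℝ) ^ 8) (X := (10 : ℝ) ^ 16)
    (by norm_num) (by norm_num) (by norm_num)
  obtain ⟨-, hu⟩ := sqrt_between (s := 3162277660) (u := 3162277661) (X := (10 : ℝ) ^ 19)
    (by norm_num) (by norm_num) (by norm_num)
  have hy := le_rpow_sixth (X := (10 : ℝ) ^ 16) (y := 464.1) (by norm_num) (by norm_num)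
  exact Eb_window_lt (b := 0.066044) (L₁ := 36.841) (U₁ := 36.842) (L₂ := 43.75) (by norm_num) h0 h1
    (by push_cast at hl0; linarith) (by push_cast at hu0; linarith) (by push_cast at hu1; linarith)
    (by norm_num) hs (by norm_num) hy (by norm_num) hu (by norm_num) (by norm_num) (by norm_num) (by norm_num)

/-- Window 3: `[10¹⁹, 5·10¹⁹]`, budget `0.09009`, box `2.0949`. -/
theorem Eb_lt_W3 {P : ℝ} (h0 : (10 : ℝ) ^ 19 ≤ P) (h1 : P ≤ 5 * (10 : ℝ) ^ 19) :
    (nicolasERH P + ((0.0463 + 2 * (1 + 2 / Real.log ((10 : ℝ) ^ 19)) * (2.961e-12 * √(5 * (10 : ℝ) ^ 19))) - nicolasBeta) * (1 / (√P * Real.log P) + 1 / (√P * Real.log P ^ 2) + 4 / (√P * Real.log P ^ 3))) * (√P * Real.log P) < 2.1538 := by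
  obtain ⟨hl0, hu0⟩ := log_ten_pow_bounds 19
  obtain ⟨h5l, h5u⟩ := log_five_bounds
  have e1 := log_mul_ten_pow (a := 5) (by norm_num) 19
  have h10 := RobinAnalytic.log_ten_lt
  obtain ⟨hs, -⟩ := sqrt_between (s := 3162277660) (u := 3162277661) (X := (10 : ℝ) ^ 19)
    (by norm_num) (by norm_num) (by norm_num)
  obtain ⟨-, hu⟩ := sqrt_between (s := 7071067811) (u := 7071067812) (X := 5 * (10 : ℝ) ^ 19)
    (by norm_num) (by norm_num) (by norm_num)
  have hy := le_rpow_sixth (X := (10 : ℝ) ^ 19) (y := 1467.7) (by norm_num) (by norm_num)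
  exact Eb_window_lt (b := 0.09009) (L₁ := 43.749) (U₁ := 43.75) (L₂ := 45.359) (by norm_num) h0 h1
    (by push_cast at hl0; linarith) (by push_cast at hu0; linarith) (by rw [e1]; push_cast; linarith)
    (by norm_num) hs (by norm_num) hy (by norm_num) hu (by norm_num) (by norm_num) (by norm_num) (by norm_num)

/-- Window 4: `[5·10¹⁹, 1.25·10²⁰]`, budget `0.11543`, box `2.1211`. -/
theorem Eb_lt_W4 {P : ℝ} (h0 : 5 * (10 : ℝ) ^ 19 ≤ P) (h1 : P ≤ 125 * (10 : ℝ) ^ 18) :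
    (nicolasERH P + ((0.0463 + 2 * (1 + 2 / Real.log (5 * (10 : ℝ) ^ 19)) * (2.961e-12 * √(125 * (10 : ℝ) ^ 18))) - nicolasBeta) * (1 / (√P * Real.log P) + 1 / (√P * Real.log P ^ 2) + 4 / (√P * Real.log P ^ 3))) * (√P * Real.log P) < 2.1538 := by
  obtain ⟨h5l, h5u⟩ := log_five_bounds
  have e0 := log_mul_ten_pow (a := 5) (by norm_num) 19
  have e1 := log_mul_ten_pow (a := 125) (by norm_num) 18
  have e125 : Real.log (125 : ℝ) = 3 * Real.log 5 := by
    rw [show (125 : ℝ) = 5 ^ 3 by norm_num, Real.log_pow]; push_cast; ring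
  have h10 := RobinAnalytic.log_ten_lt
  have h10' := RobinAnalytic.log_ten_gt
  obtain ⟨hs, -⟩ := sqrt_between (s := 7071067811) (u := 7071067812) (X := 5 * (10 : ℝ) ^ 19)
    (by norm_num) (by norm_num) (by norm_num)
  obtain ⟨-, hu⟩ := sqrt_between (s := 11180339887) (u := 11180339888) (X := 125 * (10 : ℝ) ^ 18)
    (by norm_num) (by norm_num) (by norm_num)
  have hy := le_rpow_sixth (X := 5 * (10 : ℝ) ^ 19) (y := 1919.3) (by norm_num) (by norm_num)
  exact Eb_window_lt (b := 0.11543) (L₁ := 45.358) (U₁ := 45.359) (L₂ := 46.275) (by norm_num) h0 h1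
    (by rw [e0]; push_cast; linarith) (by rw [e0]; push_cast; linarith)
    (by rw [e1, e125]; push_cast; linarith)
    (by norm_num) hs (by norm_num) hy (by norm_num) hu (by norm_num) (by norm_num) (by norm_num) (by norm_num)

/-- Window 5: `[1.25·10²⁰, 2·10²⁰]`, budget `0.13367`, box `2.1398`. -/
theorem Eb_lt_W5 {P : ℝ} (h0 : 125 * (10 : ℝ) ^ 18 ≤ P) (h1 : P ≤ 2 * (10 : ℝ) ^ 20) :
    (nicolasERH P + ((0.0463 + 2 * (1 + 2 / Real.log (125 * (10 : ℝ) ^ 18)) * (2.961e-12 * √(2 * (10 : ℝ) ^ 20))) - nicolasBeta) * (1 / (√P * Real.log P) + 1 / (√P * Real.log P ^ 2) + 4 / (√P * Real.log P ^ 3))) * (√P * Real.log P) < 2.1538 := by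
  obtain ⟨h5l, h5u⟩ := log_five_bounds
  have e0 := log_mul_ten_pow (a := 125) (by norm_num) 18
  have e125 : Real.log (125 : ℝ) = 3 * Real.log 5 := by
    rw [show (125 : ℝ) = 5 ^ 3 by norm_num, Real.log_pow]; push_cast; ring
  have e1 := log_mul_ten_pow (a := 2) (by norm_num) 20
  have h2l := Real.log_two_gt_d9
  have h2u := Real.log_two_lt_d9
  have h10 := RobinAnalytic.log_ten_lt
  have h10' := RobinAnalytic.log_ten_gt
  obtain ⟨hs, -⟩ := sqrt_between (s := 11180339887) (u := 11180339888) (X := 125 * (10 : ℝ) ^ 18)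
    (by norm_num) (by norm_num) (by norm_num)
  obtain ⟨-, hu⟩ := sqrt_between (s := 14142135623) (u := 14142135624) (X := 2 * (10 : ℝ) ^ 20)
    (by norm_num) (by norm_num) (by norm_num)
  have hy := le_rpow_sixth (X := 125 * (10 : ℝ) ^ 18) (y := 2236) (by norm_num) (by norm_num)
  exact Eb_window_lt (b := 0.13367) (L₁ := 46.274) (U₁ := 46.275) (L₂ := 46.745) (by norm_num) h0 h1
    (by rw [e0, e125]; push_cast; linarith) (by rw [e0, e125]; push_cast; linarith)
    (by rw [e1]; push_cast; linarith)
    (by norm_num) hs (by norm_num) hy (by norm_num) hu (by norm_num) (by norm_num) (by norm_num) (by norm_num)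

/-- Window 6: `[2·10²⁰, 2.5·10²⁰]`, budget `0.143942`, box `2.15036 < 2.1538` (the binding window). -/
theorem Eb_lt_W6 {P : ℝ} (h0 : 2 * (10 : ℝ) ^ 20 ≤ P) (h1 : P ≤ 25 * (10 : ℝ) ^ 19) :
    (nicolasERH P + ((0.0463 + 2 * (1 + 2 / Real.log (2 * (10 : ℝ) ^ 20)) * (2.961e-12 * √(25 * (10 : ℝ) ^ 19))) - nicolasBeta) * (1 / (√P * Real.log P) + 1 / (√P * Real.log P ^ 2) + 4 / (√P * Real.log P ^ 3))) * (√P * Real.log P) < 2.1538 := by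
  obtain ⟨h5l, h5u⟩ := log_five_bounds
  have e0 := log_mul_ten_pow (a := 2) (by norm_num) 20
  have e1 := log_mul_ten_pow (a := 25) (by norm_num) 19
  have e25 : Real.log (25 : ℝ) = 2 * Real.log 5 := by
    rw [show (25 : ℝ) = 5 ^ 2 by norm_num, Real.log_pow]; push_cast; ring
  have h2l := Real.log_two_gt_d9
  have h2u := Real.log_two_lt_d9
  have h10 := RobinAnalytic.log_ten_lt
  have h10' := RobinAnalytic.log_ten_gt
  obtain ⟨hs, -⟩ := sqrt_between (s := 14142135623) (u := 14142135624) (X := 2 * (10 : ℝ) ^ 20)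
    (by norm_num) (by norm_num) (by norm_num)
  obtain ⟨-, hu⟩ := sqrt_between (s := 15811388300) (u := 15811388301) (X := 25 * (10 : ℝ) ^ 19)
    (by norm_num) (by norm_num) (by norm_num)
  have hy := le_rpow_sixth (X := 2 * (10 : ℝ) ^ 20) (y := 2418.2) (by norm_num) (by norm_num)
  exact Eb_window_lt (b := 0.143942) (L₁ := 46.744) (U₁ := 46.745) (L₂ := 46.968) (by norm_num) h0 h1
    (by rw [e0]; push_cast; linarith) (by rw [e0]; push_cast; linarith)
    (by rw [e1, e25]; push_cast; linarith)
    (by norm_num) hs (by norm_num) hy (by norm_num) hu (by norm_num) (by norm_num) (by norm_num) (by norm_num)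

end Summit.RiemannHypothesis.RiemannHypothesis.Theorems.Splittings.RobinFiniteE3

end
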